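import Summits.HubbardSuperconductivity.HubbardSuperconductivity.Theorems.JosephsonMirrorJmInterchangeExactResidues
import Summits.HubbardSuperconductivity.HubbardSuperconductivity.Theorems.LogColdTorusAverageToEveryStubBlockAverageWitness
import Summits.HubbardSuperconductivity.HubbardSuperconductivity.Theorems.BalabanIRBirGroundStateAverageLRO
import Literature.MathematicalPhysics.QuantumLattice.PairFieldMomentum
import HarnessLib

/-!
# Route `JosephsonMirror` — crux `JmCusp` (stmt-HubbardSuperconductivity-2228), line `cocountable-coupling-selection`:
# existing suppliers of the open-core stub `stub_orderedWindow`

Helper file (`--supports` stmt-HubbardSuperconductivity-2228) recording, as kernel-checked implications between VERBATIM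
ledger statements, which EXISTING open items of other routes supply the line's (i)-side input `stub_orderedWindow`
(zero-excess `d`-wave pair order at every coupling of a window, at one doping):

* `orderedWindow_of_bir2079` — stmt-HubbardSuperconductivity-2079 `BalabanIR.BirGroundStateAverageLRO` (window
  ground-state-AVERAGE `d`-wave order, `L₀` per coupling; the logically weakest window-order item on the ledger) ⇒
  `stub_orderedWindow`, by the landed `exists_groundState_le_of_trace_bound` (a ground state with the average order)
  and `JosephsonMirror.zeroExcessPairOrder_of_floorOrder` (a ground state has zero excess);
* `orderedWindow_of_thesis1634` — stmt-HubbardSuperconductivity-1634 `AbelianDuality.Thesis` (block ground-state-average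
  order, `L₀` uniform on the window) ⇒ `stub_orderedWindow`, by `stub_blockAverageWitness` + the same.

Together with `stub_logColdGivesWindowOrder` (stmt-8807 ALONE ⇒ `stub_orderedWindow`, file
`Theorems/JosephsonMirrorJmCuspLogColdWindowOrder`) this lists the honest terminal dependencies of the line: the crux
`JmCusp` follows from ANY of stmt-2079 / stmt-1634 / stmt-8807 plus the residue `stub_noPersistentFloorMultiplet`
(skeleton `Cruxes/JmCusp/Lines/cocountable_coupling_selection.lean`).  Nothing here claims any of these items.
Found and kernel-checked by the stub-worker of `stub_orderedWindow` (lead seat c11).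

Sources: T. Koma, H. Tasaki, J. Stat. Phys. 76 (1994) 745, §2 (order of a ground state ⇒ order at vanishing excess);
folklore linear algebra (an average over ground states is attained by one of them).  No new definitions.
-/

noncomputable section

-- the mandated namespace `Summit.<Summit>.<Problem>.Theorems` repeats `HubbardSuperconductivity`
-- (single-problem summit, D-0017), which the `dupNamespace` linter flags on every declaration
set_option linter.dupNamespace false

namespace Summit.HubbardSuperconductivity.HubbardSuperconductivity.Theorems.JosephsonMirror

open scoped Classical
open Matrix Literature.MathematicalPhysics.QuantumLattice
open Summit.HubbardSuperconductivity.HubbardSuperconductivity.Theorems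

/-- **stmt-2079 ⇒ `stub_orderedWindow`.**  Window ground-state-average `d`-wave order of the `(N_L, S^z = 0)` floor
(the statement of stmt-HubbardSuperconductivity-2079 `BalabanIR.BirGroundStateAverageLRO`, verbatim) gives zero-excess
`d`-wave pair order at every coupling of the same window (the registered `stub_orderedWindow`, verbatim): an average
over the ground floor is attained by one unit ground state (`exists_groundState_le_of_trace_bound`), and a ground state
has zero excess (`zeroExcessPairOrder_of_floorOrder`).  Koma–Tasaki (1994) §2. [folklore] -/
theorem orderedWindow_of_bir2079 : (∃ δ ∈ Set.Ioo (0:ℝ) (1/2), ∃ U₁ U₂ c : ℝ, 0 < U₁ ∧ U₁ < U₂ ∧ 0 < c ∧ ∀ U ∈ Set.Ioo U₁ U₂, ∃ L₀ : ℕ, ∀ (L : ℕ) [NeZero L], L₀ ≤ L → Even L → let N : ℕ := 2 * ⌊(1 - δ) * (L : ℝ) ^ 2 / 2⌋₊; let H := Literature.MathematicalPhysics.QuantumLattice.hubbardTorus 2 L 1 U; let S := Literature.MathematicalPhysics.QuantumLattice.szSector (Λ := Literature.MathematicalPhysics.QuantumLattice.FermionTorus 2 L) N 0; let E₀ := S ⊓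 Module.End.eigenspace (Matrix.toLin' H) ((H.minEnergyOn S : ℝ) : ℂ); let P := Literature.MathematicalPhysics.QuantumLattice.projMatrix (E₀.map (Literature.MathematicalPhysics.QuantumLattice.Fock.toEuclidean (ι := Literature.MathematicalPhysics.QuantumLattice.Orb (Literature.MathematicalPhysics.QuantumLattice.FermionTorus 2 L)) : Literature.MathematicalPhysics.QuantumLattice.Fock (Literature.MathematicalPhysics.QuantumLattice.Orb (Literature.MathematicalPhysics.QuantumLattice.FermionTorus 2 L)) →ₗ[ℂ] EuclideanSpace ℂ (Finset (Literature.MathematicalPhysics.QuantumLattice.Orb (Literature.MathematicalPhysics.QuantumLattice.FermionTorus 2 L))))); c * (L : ℝ) ^ 4 * P.trace.re ≤ (P * (Matrix.conjTranspose (Literature.MathematicalPhysics.QuantumLattice.pairField Literature.MathematicalPhysics.QuantumLattice.dWaveFormFactor L) * Literature.MathematicalPhysics.QuantumLattice.pairField Literature.MathematicalPhysics.QuantumLattice.dWaveFormFactor L)).trace.re) → ∃ δ ∈ Set.Ioo (0:ℝ) (1 / 2), ∃ a b : ℝ, 0 < a ∧ a < b ∧ ∀ U ∈ Set.Ioo a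 b, ∃ c : ℝ, 0 < c ∧ ∀ ε : ℝ, 0 < ε → ∃ L₀ : ℕ, ∀ (L : ℕ) [NeZero L], Even L → L₀ ≤ L → ∃ n : ℕ, (n = 2 * ⌊(1 - δ) * (L : ℝ) ^ 2 / 2⌋₊ ∨ n = 2 * ⌊(1 - δ) * (L : ℝ) ^ 2 / 2⌋₊ - 2) ∧ ∃ v : Literature.MathematicalPhysics.QuantumLattice.Fock (Literature.MathematicalPhysics.QuantumLattice.Orb (Literature.MathematicalPhysics.QuantumLattice.FermionTorus 2 L)), v ∈ Literature.MathematicalPhysics.QuantumLattice.szSector n 0 ∧ star v ⬝ᵥ v = 1 ∧ (star v ⬝ᵥ (Literature.MathematicalPhysics.QuantumLattice.hubbardTorus 2 L 1 U *ᵥ v)).re ≤ (Literature.MathematicalPhysics.QuantumLattice.hubbardTorus 2 L 1 U).minEnergyOn (Literature.MathematicalPhysics.QuantumLattice.szSector n 0) + ε * (L : ℝ) ^ 2 ∧ c * (L : ℝ) ^ 4 ≤ (star (Literature.MathematicalPhysics.QuantumLattice.pairField Literature.MathematicalPhysics.QuantumLattice.dWaveFormFactor L *ᵥ v) ⬝ᵥ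 (Literature.MathematicalPhysics.QuantumLattice.pairField Literature.MathematicalPhysics.QuantumLattice.dWaveFormFactor L *ᵥ v)).re := by
  intro h
  obtain ⟨δ, hδ, U₁, U₂, c, hU₁, hU₁₂, hc, hwin⟩ := h
  refine ⟨δ, hδ, U₁, U₂, hU₁, hU₁₂, fun U hU => ?_⟩
  obtain ⟨L₀, hL₀⟩ := hwin U hU
  refine zeroExcessPairOrder_of_floorOrder U δ ⟨c, hc, L₀, fun L _ hE hL => ?_⟩
  have havg := hL₀ L hL hE
  obtain ⟨ψ, hgs, hψ1, hord⟩ :=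
    exists_groundState_le_of_trace_bound L 1 U δ c (by linarith [hδ.1]) havg
  exact ⟨ψ, hgs, hψ1, by rwa [Literature.MathematicalPhysics.QuantumLattice.star_mulVec_dotProduct_mulVec]⟩

/-- **stmt-1634 ⇒ `stub_orderedWindow`.**  Block ground-state-average `d`-wave order on a window with a uniform
threshold (the statement of stmt-HubbardSuperconductivity-1634 `AbelianDuality.Thesis`, verbatim) gives zero-excess
`d`-wave pair order at every coupling of the window (`stub_orderedWindow`, verbatim), via `stub_blockAverageWitness`
and `zeroExcessPairOrder_of_floorOrder`.  Koma–Tasaki (1994) §2. [folklore] -/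
theorem orderedWindow_of_thesis1634 : (∃ δ ∈ Set.Ioo (0:ℝ) (1/2), ∃ U₁ U₂ : ℝ, 0 < U₁ ∧ U₁ < U₂ ∧ ∃ c : ℝ, 0 < c ∧ ∃ L₀ : ℕ, ∀ U ∈ Set.Ioo U₁ U₂, ∀ (L : ℕ) [NeZero L], L₀ ≤ L → Even L → let p : Finset (Literature.MathematicalPhysics.QuantumLattice.Orb (Literature.MathematicalPhysics.QuantumLattice.FermionTorus 2 L)) → Prop := fun s => s.card = 2 * ⌊(1 - δ) * (L : ℝ) ^ 2 / 2⌋₊ ∧ 2 * (s.filter fun i => (ofLex i).2 = 0).card = 2 * ⌊(1 - δ) * (L : ℝ) ^ 2 / 2⌋₊; c * (L : ℝ) ^ 4 ≤ (((Literature.MathematicalPhysics.QuantumLattice.hubbardTorus 2 L 1 U).toBlock p p).groundStateFunctional (((Literature.MathematicalPhysics.QuantumLattice.pairField Literature.MathematicalPhysics.QuantumLattice.dWaveFormFactor L)ᴴ * Literature.MathematicalPhysics.QuantumLattice.pairField Literature.MathematicalPhysics.QuantumLattice.dWaveFormFactor L).toBlock p p)).re) → ∃ δ ∈ Set.Ioo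 (0:ℝ) (1 / 2), ∃ a b : ℝ, 0 < a ∧ a < b ∧ ∀ U ∈ Set.Ioo a b, ∃ c : ℝ, 0 < c ∧ ∀ ε : ℝ, 0 < ε → ∃ L₀ : ℕ, ∀ (L : ℕ) [NeZero L], Even L → L₀ ≤ L → ∃ n : ℕ, (n = 2 * ⌊(1 - δ) * (L : ℝ) ^ 2 / 2⌋₊ ∨ n = 2 * ⌊(1 - δ) * (L : ℝ) ^ 2 / 2⌋₊ - 2) ∧ ∃ v : Literature.MathematicalPhysics.QuantumLattice.Fock (Literature.MathematicalPhysics.QuantumLattice.Orb (Literature.MathematicalPhysics.QuantumLattice.FermionTorus 2 L)), v ∈ Literature.MathematicalPhysics.QuantumLattice.szSector n 0 ∧ star v ⬝ᵥ v = 1 ∧ (star v ⬝ᵥ (Literature.MathematicalPhysics.QuantumLattice.hubbardTorus 2 L 1 U *ᵥ v)).re ≤ (Literature.MathematicalPhysics.QuantumLattice.hubbardTorus 2 L 1 U).minEnergyOn (Literature.MathematicalPhysics.QuantumLattice.szSector n 0) + ε * (L : ℝ) ^ 2 ∧ c * (L : ℝ) ^ 4 ≤ (star (Literature.MathematicalPhysics.QuantumLattice.pairField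 Literature.MathematicalPhysics.QuantumLattice.dWaveFormFactor L *ᵥ v) ⬝ᵥ (Literature.MathematicalPhysics.QuantumLattice.pairField Literature.MathematicalPhysics.QuantumLattice.dWaveFormFactor L *ᵥ v)).re := by
  intro h
  obtain ⟨δ, hδ, U₁, U₂, hU₁, hU₁₂, c, hc, L₀, hwin⟩ := h
  refine ⟨δ, hδ, U₁, U₂, hU₁, hU₁₂, fun U hU => ?_⟩
  refine zeroExcessPairOrder_of_floorOrder U δ ⟨c, hc, L₀, fun L _ hE hL => ?_⟩
  have havg := hwin U hU L hL hE
  obtain ⟨ψ, hgs, hψ1, hord⟩ :=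
    stub_blockAverageWitness U c L ⌊(1 - δ) * (L : ℝ) ^ 2 / 2⌋₊ hc havg
  exact ⟨ψ, hgs, hψ1, by rwa [Literature.MathematicalPhysics.QuantumLattice.star_mulVec_dotProduct_mulVec]⟩

end Summit.HubbardSuperconductivity.HubbardSuperconductivity.Theorems.JosephsonMirror

end
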